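import Summits.Ventures.HodgeRepro2.T5RecordSphericalSpectrumSevenToy
import Summits.Ventures.HodgeRepro2.T5RecordLatticeModelSeven

/-!
# Joint consistency on one toy instance: `ℚ(ζ₇)` at the inert place `(3)`

Tier-5 support N3 / §G-N4.2 (seat p3, gen 86). README §10.5 (ii)(d) asks that the hypotheses of the displayed
statements «instantiate simultaneously on at least one toy / model instance». The lane's two capstone statements —
the lattice-model data of §N3.10.3 (file 331) and the unramified spectrum of the record's pair (file 344) — are
here instantiated AT ONCE on the brief's sextic Galois CM field of record `K7 = ℚ(ζ₇)` at the inert place `(3)` of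
`ℚ(ζ₇)⁺` (file 253, `N(v) = 27`), above the place `(3)` of `ℚ`, with every datum explicit: `M = diag(1, 1, −1)`
(file 348), the datum `(θ, y) = (−7, √−7)` (file 145), the generators from file 235 (file 347):

* **`joint_seven_three`** — (i) an additive character `ψ : ℚ₃ → S¹` of conductor exponent `0` with
  `n(ψ ∘ Tr) = 0` exists, and for every such `ψ` and every `w ∣ (3)`: `e = 1`, `n(ψ_w) = 0`, `𝒪_w` is
  `ψ_w`-self-dual, `𝒪_w³` is `ψ_w`-self-dual for `diag(1, 1, −1)` under any integrality-preserving star and so is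
  the split pair; AND (ii) generators `l` of `𝓞_{ℚ(ζ₇)}` over `𝓞_{ℚ(ζ₇)⁺}` exist with `u₀`, an isomorphism
  `Φ : U(J₃(u₀)) ≃* U(1 ⊗ H₀)` matching the hyperspecial subgroups, a star-fixed uniformiser `ϖ'`, such that every
  irreducible `K_{(3)}`-finite representation of `U(1 ⊗ H₀)` with non-zero finite-dimensional `K_{(3)}`-invariants
  is `≅ (inertSphericalQuot (α · (27²)⁻¹)) ∘ Φ⁻¹` for some `α ≠ 0`.

The proof is the pair of files 348 and 347 at `K7`; nothing is re-proved. §8(d): uses an L-value-free non-vanishing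
device: NO.
-/

open Matrix NumberField NumberField.IsCMField IsDedekindDomain IsDedekindDomain.HeightOneSpectrum Module
  MulAction
open scoped TensorProduct Pointwise
open Summit.Ventures.HodgeRepro2.T5UnitaryGroupForm Summit.Ventures.HodgeRepro2.T5UnitaryHeckeAdjoint
  Summit.Ventures.HodgeRepro2.T5HeckePermutationModule Summit.Ventures.HodgeRepro2.LevelPositivity
  Summit.Ventures.HodgeRepro2.T5LevelIdempotent Summit.Ventures.HodgeRepro2.T5StarOfInvolution
  Summit.Ventures.HodgeRepro2.T5FinitePlaceCM Summit.Ventures.HodgeRepro2.T5NonSplitPlaceUnitaryGroup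
  Summit.Ventures.HodgeRepro2.T5RecordHyperspecial Summit.Ventures.HodgeRepro2.T5GlobalLatticeAlmostAll
  Summit.Ventures.HodgeRepro2.T5HermitianThreeElements Summit.Ventures.HodgeRepro2.T5GaloisCartanThree
  Summit.Ventures.HodgeRepro2.T5InertDegreeGalois Summit.Ventures.HodgeRepro2.T5InertPlaceCompletion
  Summit.Ventures.HodgeRepro2.T5InertDegreeAdicCompletion Summit.Ventures.HodgeRepro2.T5InertSatakeTransform
  Summit.Ventures.HodgeRepro2.T5InertSatakeTransformCompletion Summit.Ventures.HodgeRepro2.T5InertUnipotentResidue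
  Summit.Ventures.HodgeRepro2.T5InertSphericalSubquotient Summit.Ventures.HodgeRepro2.T5RecordSatakeCell
  Summit.Ventures.HodgeRepro2.T5SplitPlaceUnitaryGroup Summit.Ventures.HodgeRepro2.T5FinitePlaceNormIndex
  Summit.Ventures.HodgeRepro2.T5HermitianLocalIsotropyN3 Summit.Ventures.HodgeRepro2.T5FinitePlaceSplitClassification
  Summit.Ventures.HodgeRepro2.T5InertDegreeCompletion Summit.Ventures.HodgeRepro2.T5InertPlaceCompletionCells
  Summit.Ventures.HodgeRepro2.T5RecordSatake Summit.Ventures.HodgeRepro2.T5CartanCellsDistinct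
  Summit.Ventures.HodgeRepro2.T5RecordSatakeInert Summit.Ventures.HodgeRepro2.T5InertGlobalPrime
  Summit.Ventures.HodgeRepro2.T5CMFieldSquareDatum Summit.Ventures.HodgeRepro2.T5RecordSatakeDegree
  Summit.Ventures.HodgeRepro2.T5RecordSatakeDegreeIntrinsic Summit.Ventures.HodgeRepro2.T5RecordSphericalSpectrum
  Summit.Ventures.HodgeRepro2.T5RecordSphericalSpectrumIntrinsic Summit.Ventures.HodgeRepro2.T5RecordSatakeToy
  Summit.Ventures.HodgeRepro2.T5CyclotomicSevenInertThree Summit.Ventures.HodgeRepro2.T5CyclotomicSevenNonDyadic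
  Summit.Ventures.HodgeRepro2.CyclotomicSeven Summit.Ventures.HodgeRepro2.T5RecordSphericalSpectrumSevenToy
  Summit.Ventures.HodgeRepro2.T5AdditiveConductor Summit.Ventures.HodgeRepro2.T5UnitaryGroupIsometry
  Summit.Ventures.HodgeRepro2.T5ConductorDualLattice Summit.Ventures.HodgeRepro2.T5ConductorDualLatticeSplit
  Summit.Ventures.HodgeRepro2.T5SplitHermitianClass Summit.Ventures.HodgeRepro2.T5RecordLatticeModelSeven

namespace Summit.Ventures.HodgeRepro2.T5RecordSevenThreeJoint

universe uV

/-- **JOINT CONSISTENCY ON `ℚ(ζ₇)` AT `(3)`**: the lattice-model data of §N3.10.3 for `M = diag(1, 1, −1)` (file 348)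
AND the unramified spectrum of the record's pair with the explicit datum `(−7, √−7)` and the generators supplied
(file 347), at the same place `vThreeSeven K7` over `vThree`, for any algebraically closed field `k` of
characteristic `0`. -/
theorem joint_seven_three (k : Type*) [Field k] [CharZero k] [IsAlgClosed k] :
      ((∃ ψ : AddChar ((T5InertPrimeToy.vThree).adicCompletion ℚ) Circle, Continuous ψ ∧ (∃ y, ψ y ≠ 1) ∧
        conductorExp ψ (Valued.v : Valuation ((T5InertPrimeToy.vThree).adicCompletion ℚ) (WithZero (Multiplicative ℤ))) = 0 ∧
        conductorExp (ψ.compAddMonoidHom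
          (Algebra.trace ((T5InertPrimeToy.vThree).adicCompletion ℚ) ((vThreeSeven K7).adicCompletion (maximalRealSubfield K7))).toAddMonoidHom)
          (Valued.v : Valuation ((vThreeSeven K7).adicCompletion (maximalRealSubfield K7)) (WithZero (Multiplicative ℤ))) = 0) ∧
      ∀ (ψ : AddChar ((T5InertPrimeToy.vThree).adicCompletion ℚ) Circle), Continuous ψ → (∃ y, ψ y ≠ 1) →
        conductorExp ψ (Valued.v : Valuation ((T5InertPrimeToy.vThree).adicCompletion ℚ) (WithZero (Multiplicative ℤ))) = 0 →
        ∀ (w : HeightOneSpectrum (𝓞 K7)) [w.asIdeal.LiesOver (vThreeSeven K7).asIdeal],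
          (vThreeSeven K7).asIdeal.ramificationIdx' w.asIdeal = 1 ∧
          conductorExp (recordChar K7 (T5InertPrimeToy.vThree) (vThreeSeven K7) w ψ)
            (Valued.v : Valuation (w.adicCompletion K7) (WithZero (Multiplicative ℤ))) = 0 ∧
          (∀ x : w.adicCompletion K7,
            (∀ y : w.adicCompletion K7, Valued.v y ≤ 1 → recordChar K7 (T5InertPrimeToy.vThree) (vThreeSeven K7) w ψ (x * y) = 1) ↔ Valued.v x ≤ 1) ∧
          (∀ [StarRing (w.adicCompletion K7)],
            (∀ z : w.adicCompletion K7, IsLocalization.IsInteger (w.adicCompletionIntegers K7) z →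
              IsLocalization.IsInteger (w.adicCompletionIntegers K7) (star z)) →
            ∀ x : Fin 3 → w.adicCompletion K7,
              (∀ y ∈ stdLattice (w.adicCompletionIntegers K7),
                recordChar K7 (T5InertPrimeToy.vThree) (vThreeSeven K7) w ψ
                  (sesqForm (((algebraMap (𝓞 K7) K7).mapMatrix (Matrix.diagonal ![1, 1, -1])).map (algebraMap K7 (w.adicCompletion K7))) x y) = 1) ↔
                x ∈ stdLattice (w.adicCompletionIntegers K7)) ∧
          (letI := swapStarRing (w.adicCompletion K7)
            ∀ x : Fin 3 → w.adicCompletion K7 × w.adicCompletion K7,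
              (∀ y : Fin 3 → w.adicCompletion K7 × w.adicCompletion K7,
                (∀ i, Valued.v (y i).1 ≤ 1 ∧ Valued.v (y i).2 ≤ 1) →
                recordChar K7 (T5InertPrimeToy.vThree) (vThreeSeven K7) w ψ
                    (sesqForm (pairMatrix (((algebraMap (𝓞 K7) K7).mapMatrix (Matrix.diagonal ![1, 1, -1])).map (algebraMap K7 (w.adicCompletion K7)))
                      (((algebraMap (𝓞 K7) K7).mapMatrix (Matrix.diagonal ![1, 1, -1])).map (algebraMap K7 (w.adicCompletion K7)))ᵀ) x y).1 *
                  recordChar K7 (T5InertPrimeToy.vThree) (vThreeSeven K7) w ψ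
                    (sesqForm (pairMatrix (((algebraMap (𝓞 K7) K7).mapMatrix (Matrix.diagonal ![1, 1, -1])).map (algebraMap K7 (w.adicCompletion K7)))
                      (((algebraMap (𝓞 K7) K7).mapMatrix (Matrix.diagonal ![1, 1, -1])).map (algebraMap K7 (w.adicCompletion K7)))ᵀ) x y).2 = 1) ↔
                ∀ i, Valued.v (x i).1 ≤ 1 ∧ Valued.v (x i).2 ≤ 1)) ∧
      (∃ (r : ℕ) (l : Fin r → 𝓞 K7), Submodule.span (𝓞 (maximalRealSubfield K7)) (Set.range l) = ⊤ ∧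
        (letI := tensorStarRing K7 (vThreeSeven K7)
        letI := starRingOfQuadratic (finrank_eq_two K7 (vThreeSeven K7) (wThreeSeven K7) neg_seven_eq_sqrtNegSeven_sq complexConj_sqrtNegSeven_ne
            (not_isSquare_of_staysPrime K7 (vThreeSeven K7) (wThreeSeven K7) neg_seven_eq_sqrtNegSeven_sq complexConj_sqrtNegSeven_ne (map_vThreeSeven K7)))
          (localConj (vThreeSeven K7) (wThreeSeven K7) neg_seven_eq_sqrtNegSeven_sq.symm (span_pair_eq_top K7 complexConj_sqrtNegSeven_ne)
            (not_isSquare_of_staysPrime K7 (vThreeSeven K7) (wThreeSeven K7) neg_seven_eq_sqrtNegSeven_sq complexConj_sqrtNegSeven_ne (map_vThreeSeven K7))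
            (complexConj K7))
          (localConj_ne_one (vThreeSeven K7) (wThreeSeven K7) neg_seven_eq_sqrtNegSeven_sq.symm (span_pair_eq_top K7 complexConj_sqrtNegSeven_ne)
            (not_isSquare_of_staysPrime K7 (vThreeSeven K7) (wThreeSeven K7) neg_seven_eq_sqrtNegSeven_sq complexConj_sqrtNegSeven_ne (map_vThreeSeven K7))
            (complexConj K7) (complexConj_apply_eq_neg K7 neg_seven_eq_sqrtNegSeven_sq complexConj_sqrtNegSeven_ne))
        haveI := isDiscreteValuationRing_integralClosure_adicCompletion (vThreeSeven K7) (wThreeSeven K7)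
        haveI := finite_residueField_integralClosure_adicCompletion (vThreeSeven K7) (wThreeSeven K7)
        haveI : IsFractionRing (integralClosure ((vThreeSeven K7).adicCompletionIntegers (maximalRealSubfield K7))
            ((wThreeSeven K7).adicCompletion K7)) ((wThreeSeven K7).adicCompletion K7) :=
          integralClosure.isFractionRing_of_finite_extension ((vThreeSeven K7).adicCompletion (maximalRealSubfield K7))
            ((wThreeSeven K7).adicCompletion K7)
        ∃ (u₀ : ((vThreeSeven K7).adicCompletionIntegers (maximalRealSubfield K7))ˣ)
          (Φ : ↥(formUnitaryGroup (J3 (algebraMap ((vThreeSeven K7).adicCompletionIntegers (maximalRealSubfield K7))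
            ((wThreeSeven K7).adicCompletion K7)
            (u₀ : (vThreeSeven K7).adicCompletionIntegers (maximalRealSubfield K7))))) ≃*
            ↥(formUnitaryGroup (tensorGram K7 (vThreeSeven K7) (gramToy K7))))
          (ϖ' : integralClosure ((vThreeSeven K7).adicCompletionIntegers (maximalRealSubfield K7))
            ((wThreeSeven K7).adicCompletion K7))
          (hϖ' : Irreducible ϖ')
          (hs' : star (algebraMap (integralClosure ((vThreeSeven K7).adicCompletionIntegers (maximalRealSubfield K7))
            ((wThreeSeven K7).adicCompletion K7)) ((wThreeSeven K7).adicCompletion K7) ϖ') =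
              algebraMap (integralClosure ((vThreeSeven K7).adicCompletionIntegers (maximalRealSubfield K7))
                ((wThreeSeven K7).adicCompletion K7)) ((wThreeSeven K7).adicCompletion K7) ϖ'),
          (∀ g, g ∈ hyperspecialSubgroup
              (integralClosure ((vThreeSeven K7).adicCompletionIntegers (maximalRealSubfield K7))
                ((wThreeSeven K7).adicCompletion K7))
              (J3 (algebraMap ((vThreeSeven K7).adicCompletionIntegers (maximalRealSubfield K7))
                ((wThreeSeven K7).adicCompletion K7)
                (u₀ : (vThreeSeven K7).adicCompletionIntegers (maximalRealSubfield K7)))) ↔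
              Φ g ∈ recordHyperspecial K7 (vThreeSeven K7) l (gramToy K7)) ∧
          ∀ {V : Type uV} [AddCommGroup V] [Module k V]
            (ρ : Representation k (↥(formUnitaryGroup (tensorGram K7 (vThreeSeven K7) (gramToy K7)))) V) [ρ.IsIrreducible],
            KFinite ρ (recordHyperspecial K7 (vThreeSeven K7) l (gramToy K7)) →
            ∀ [FiniteDimensional k (invariants ρ (recordHyperspecial K7 (vThreeSeven K7) l (gramToy K7)))],
            invariants ρ (recordHyperspecial K7 (vThreeSeven K7) l (gramToy K7)) ≠ ⊥ →
            ∃ α : k, α ≠ 0 ∧ Nonempty (ρ.Equiv (comp Φ.symm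
              (inertSphericalQuot
                (hstar_of_star_eq (localConj (vThreeSeven K7) (wThreeSeven K7) neg_seven_eq_sqrtNegSeven_sq.symm (span_pair_eq_top K7 complexConj_sqrtNegSeven_ne)
                  (not_isSquare_of_staysPrime K7 (vThreeSeven K7) (wThreeSeven K7) neg_seven_eq_sqrtNegSeven_sq complexConj_sqrtNegSeven_ne (map_vThreeSeven K7))
                  (complexConj K7))
                  (fun x => by
                    rw [star_p8_eq_star K7 (vThreeSeven K7) (wThreeSeven K7) neg_seven_eq_sqrtNegSeven_sq complexConj_sqrtNegSeven_ne
                      (not_isSquare_of_staysPrime K7 (vThreeSeven K7) (wThreeSeven K7) neg_seven_eq_sqrtNegSeven_sq complexConj_sqrtNegSeven_ne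
                        (map_vThreeSeven K7))]
                    rfl))
                (algebraMap ((vThreeSeven K7).adicCompletionIntegers (maximalRealSubfield K7))
                  ((wThreeSeven K7).adicCompletion K7)
                  (u₀ : (vThreeSeven K7).adicCompletionIntegers (maximalRealSubfield K7)))
                (star_algebraMap_of_star_eq (localConj (vThreeSeven K7) (wThreeSeven K7) neg_seven_eq_sqrtNegSeven_sq.symm
                  (span_pair_eq_top K7 complexConj_sqrtNegSeven_ne)
                  (not_isSquare_of_staysPrime K7 (vThreeSeven K7) (wThreeSeven K7) neg_seven_eq_sqrtNegSeven_sq complexConj_sqrtNegSeven_ne (map_vThreeSeven K7))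
                  (complexConj K7))
                  (fun x => by
                    rw [star_p8_eq_star K7 (vThreeSeven K7) (wThreeSeven K7) neg_seven_eq_sqrtNegSeven_sq complexConj_sqrtNegSeven_ne
                      (not_isSquare_of_staysPrime K7 (vThreeSeven K7) (wThreeSeven K7) neg_seven_eq_sqrtNegSeven_sq complexConj_sqrtNegSeven_ne
                        (map_vThreeSeven K7))]
                    rfl)
                  (u₀ : (vThreeSeven K7).adicCompletionIntegers (maximalRealSubfield K7)))
                (algebraMap_unit_ne_zero (F := (vThreeSeven K7).adicCompletion (maximalRealSubfield K7)) u₀)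
                (isInteger_algebraMap (u₀ : (vThreeSeven K7).adicCompletionIntegers (maximalRealSubfield K7)))
                (isInteger_algebraMap_unit_inv u₀) hϖ' hs' k (α * ((27 : k) ^ 2)⁻¹)))))) :=
  ⟨record_lattice_model_seven_three_diagonal K7,
    exists_generators_and_mulEquiv_forall_nonempty_equiv_inertSphericalQuot_record_seven_three_K7 k⟩

end Summit.Ventures.HodgeRepro2.T5RecordSevenThreeJoint
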